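import Summits.Ventures.Crystal3D.Bulk.TopCutInstance
import Summits.Ventures.Crystal3D.Bulk.BulkOfGapComputational
import HarnessLib

/-!
# WINDOW + CUT ⇒ bulk crystallization, with BIMODAL(1.26) DISCHARGED by the tree
# (computational companion of `Bulk/GapWindow.lean`, `Bulk/SphereCodeCut.lean`,
# `Bulk/TopCutInstance.lean`)

HONEST FRAMING. Part of the venture `Summits/Ventures/Crystal3D` (cell `pub-crystal3d`, phase 2,
24-hour decision sprint; seat typer-bulk; coordinator 2026-08-22T21:44:56Z: "BIMODAL(1.26) is
ALREADY KERNEL — the glue should IMPORT it: GAP ∧ BIMODAL ⇒ L12 ⇒ BulkCrystallization3D with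
BIMODAL discharged by the tree term, GAP as the named hypothesis until certified").
COMPUTATIONAL FILE: through `Bulk/BulkOfGapComputational.lean` it imports the tree's verified
kissing-configuration search (`Hales2012_kissingConfigCongruent_holds`, Hales 2012 Theorem 3 +
Lemmas 9–10, `native_decide`), so every theorem below depends on that run's 128 `native_decide`
axioms (compiler-trust class, `Lean.ofReduceBool`) besides the standard three. With BIMODAL so
discharged, bulk crystallization (`K = 702`, hence `1296`) is conditional on the sprint's GAP
inputs ALONE — for the plain (AG) form this is already in the tree
(`TammesBridge.bulkCrystallization3D_sharp_of_noHole : NoHole 0.63 → BulkCrystallization3D 702`,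
`bulkCrystallization3D_of_noHole'`, `bulkCrystallization3D_sharp_of_gapTuple_252`); here in each
of the DECOMPOSED shapes the DECISION may certify:

* `bulkCrystallization3D_of_window_one' : ExtremalFreeWindow 1 1.26 → BulkCrystallization3D 702`
  — a census clearing ALL hole radii `[50.949877°, 60°]` (the `60°` cut is the proved kissing
  theorem, `noHole_half`);
* `bulkCrystallization3D_of_noHole_of_window' : NoHole t₁ → ExtremalFreeWindow (2t₁) 1.26 → …`
  — any cut `ρ* < arccos t₁` plus the census of `[50.949877°, arccos t₁]`;
* `bulkCrystallization3D_of_topCut_of_window' :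
    SphereCodeBoundInner (1299/2500) → ExtremalFreeWindow 1.118 1.26 → BulkCrystallization3D 702`
  — p2's exact SDP top cut `T13(58.694576°)` plus the census of `[50.949877°, 56.0134°]`;
* `bulkCrystallization3D_of_capCodeBound_of_window' : CapCodeBound (−t₁) →
    ExtremalFreeWindow (2t₁) 1.26 → …` — idea-2's cap-SDP cut plus the census above it;
* `bulkCrystallization3D_of_tammes13_of_window'`-type statements are NOT needed: modulo
  `musinTarasov2012_tammes_thirteen` the tree already proves `BulkCrystallization3D 702` outright
  (`Bulk/BulkOfTammes.lean`).

Nothing is asserted about GAP(1.26); each hypothesis is exactly what a certified computation of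
the cell must supply (`TARGET-GAP.md`, `DECISION-GAP`).
-/

noncomputable section

namespace Summit.Ventures.Crystal3D

open Literature.Geometry.DiscreteGeometry

/-- **WHOLE WINDOW ⇒ bulk crystallization** (computational): a census clearing the intruder
distances `[1, 1.26]` (hole radii `[50.949877°, 60°]`; no cut needed beyond the proved kissing
theorem) gives `BulkCrystallization3D 702`. -/
theorem bulkCrystallization3D_of_window_one' (hwin : ExtremalFreeWindow 1 1.26) :
    BulkCrystallization3D 702 :=
  bulkCrystallization3D_sharp_of_gapTuple_252 (gapTuple_252_of_noHole (noHole_063_of_window_one hwin))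

/-- **CUT + WINDOW ⇒ bulk crystallization** (computational): a cut `NoHole t₁`
(`ρ* < arccos t₁`) and a census clearing `[2t₁, 1.26]` give `BulkCrystallization3D 702`. -/
theorem bulkCrystallization3D_of_noHole_of_window' {t₁ : ℝ} (h₁ : NoHole t₁)
    (hwin : ExtremalFreeWindow (2 * t₁) 1.26) : BulkCrystallization3D 702 :=
  bulkCrystallization3D_sharp_of_gapTuple_252
    (gapTuple_252_of_noHole (noHole_063_of_noHole_of_window h₁ hwin))

/-- The same with the census in schema form (`GapCensus.CompleteReducedOn` — theory seats;
`GapCensus.AllKilled` — engines ×2). -/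
theorem bulkCrystallization3D_of_noHole_of_census' (S : GapCensus) {t₁ : ℝ} (h₁ : NoHole t₁)
    (hC : S.CompleteReducedOn (2 * t₁) 1.26) (hK : S.AllKilled) : BulkCrystallization3D 702 :=
  bulkCrystallization3D_of_noHole_of_window' h₁ (S.extremalFreeWindow hC hK)

/-- **TOP CUT + WINDOW ⇒ bulk crystallization** (computational; the sprint's route to the label
UNCONDITIONAL-modulo-certified-computation, `DECISION-GAP` §2.U): p2's exact SDP certificate
`SphereCodeBoundInner (1299/2500)` (no 13 unit vectors with pairwise inner products `≤ 0.5196`)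
and a census clearing the intruder distances `[1.118, 1.26]` (hole radii `[50.949877°,
56.0134°]`, both implementations) give `BulkCrystallization3D 702`. Trust base: the two certified
computations named in the hypotheses + `Lean.ofReduceBool` (the tree's kissing search). -/
theorem bulkCrystallization3D_of_topCut_of_window' (hT : SphereCodeBoundInner (1299 / 2500))
    (hwin : ExtremalFreeWindow 1.118 1.26) : BulkCrystallization3D 702 :=
  bulkCrystallization3D_sharp_of_gapTuple_252
    (gapTuple_252_of_noHole (noHole_063_of_topCut_of_window hT hwin))

/-- The same with the census in schema form. -/
theorem bulkCrystallization3D_of_topCut_of_census' (hT : SphereCodeBoundInner (1299 / 2500))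
    (S : GapCensus) (hC : S.CompleteReducedOn 1.118 1.26) (hK : S.AllKilled) :
    BulkCrystallization3D 702 :=
  bulkCrystallization3D_of_topCut_of_window' hT (S.extremalFreeWindow hC hK)

/-- **CAP CUT + WINDOW ⇒ bulk crystallization** (computational; idea-2's codes-in-caps lane): an
exact cap certificate `CapCodeBound (−t₁)` (no twelve-point `60°`-code in a closed cap
`⟪e, x⟫ ≥ −t₁`, i.e. `ρ* < arccos t₁`) and a census clearing `[2t₁, 1.26]` give
`BulkCrystallization3D 702`. -/
theorem bulkCrystallization3D_of_capCodeBound_of_window' {t₁ : ℝ} (hc : CapCodeBound (-t₁))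
    (hwin : ExtremalFreeWindow (2 * t₁) 1.26) : BulkCrystallization3D 702 :=
  bulkCrystallization3D_of_noHole_of_window' (noHole_of_capCodeBound hc) hwin

/-- The `K = 1296` currency of `Bulk/LocalTwelve.lean` follows by `BulkCrystallization3D.mono`
(`702 ≤ 1296`); recorded once for the top-cut route. -/
theorem bulkCrystallization3D_1296_of_topCut_of_window' (hT : SphereCodeBoundInner (1299 / 2500))
    (hwin : ExtremalFreeWindow 1.118 1.26) : BulkCrystallization3D 1296 :=
  (bulkCrystallization3D_of_topCut_of_window' hT hwin).mono (by norm_num)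

end Summit.Ventures.Crystal3D

end
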